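import Summits.Ventures.PercRepro0.Bridge

/-! # L1 · MONOTONE in Lean: the monotone coupling of the product Bernoulli measures (p5)

Standard coupling (MEMO-p5-v1 §2, Lemma 2.3; ROUTE-v1 L1): let `(U_i)_{i ∈ ι}` be i.i.d. uniform on
`[0,1]` and put `ω_p = { i ∈ u : U_i ≤ p }`. Then `ω_p` has law `setBer(u, p)` (`map_threshold_eq_setBernoulli`),
and `ω_p ⊆ ω_q` for `p ≤ q` (`threshold_mono`); hence `P_p(A) ≤ P_q(A)` for every measurable increasing event
(`setBernoulli_mono_of_isUpperSet`), which is L1 for the percolation measures (`L1_Monotone_holds`).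
Consequences: `θ_d` is monotone, `p_c(d)` is also the supremum of `{ p ∈ [0,1] : θ_d(p) = 0 }`, and
`θ_d(p) > 0` for `p > p_c(d)`.
-/

namespace Summit.Ventures.PercRepro0.Defs

open MeasureTheory ProbabilityTheory unitInterval Set
open scoped ENNReal NNReal

section Coupling

variable {ι : Type*}

/-- The uniform law on `[0,1]`: Lebesgue measure restricted to `[0,1]`. -/
noncomputable def unif : Measure ℝ := volume.restrict (Icc (0 : ℝ) 1)

/-- `unif` has total mass `1`. -/
theorem unif_univ : unif univ = 1 := by
  simp [unif, Real.volume_Icc]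

/-- `unif` is a probability measure. -/
instance instIsProbabilityMeasureUnif : IsProbabilityMeasure unif := ⟨unif_univ⟩

/-- `unif (Icc 0 p) = p` for `p ∈ [0,1]`. -/
theorem unif_Iic (p : I) : unif (Iic (p : ℝ)) = ENNReal.ofReal p := by
  have h : Iic (p : ℝ) ∩ Icc (0 : ℝ) 1 = Icc (0 : ℝ) p := by
    ext x
    simp only [mem_inter_iff, mem_Iic, mem_Icc]
    exact ⟨fun ⟨h1, h2, _⟩ => ⟨h2, h1⟩, fun ⟨h1, h2⟩ => ⟨h2, h1, h2.trans p.2.2⟩⟩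
  rw [unif, Measure.restrict_apply measurableSet_Iic, h, Real.volume_Icc, sub_zero]

/-- `unif (Ioi p) = 1 − p` for `p ∈ [0,1]`. -/
theorem unif_Ioi (p : I) : unif (Ioi (p : ℝ)) = ENNReal.ofReal (1 - p) := by
  have h : Ioi (p : ℝ) ∩ Icc (0 : ℝ) 1 = Ioc (p : ℝ) 1 := by
    ext x
    simp only [mem_inter_iff, mem_Ioi, mem_Icc, mem_Ioc]
    exact ⟨fun ⟨h1, _, h3⟩ => ⟨h1, h3⟩, fun ⟨h1, h2⟩ => ⟨h1, p.2.1.trans h1.le, h2⟩⟩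
  rw [unif, Measure.restrict_apply measurableSet_Ioi, h, Real.volume_Ioc]

/-- The threshold map `U ↦ { i ∈ u : U i ≤ p }`. -/
def threshold (u : Set ι) (p : I) (U : ι → ℝ) : Set ι := {i | i ∈ u ∧ U i ≤ p}

/-- Thresholds are monotone in `p`. -/
theorem threshold_mono (u : Set ι) {p q : I} (hpq : p ≤ q) (U : ι → ℝ) :
    threshold u p U ⊆ threshold u q U :=
  fun _ hi => ⟨hi.1, hi.2.trans hpq⟩

/-- One coordinate of the threshold map is measurable. -/
theorem measurable_threshold_coord (u : Set ι) (p : I) (i : ι) :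
    Measurable fun x : ℝ => (i ∈ u ∧ x ≤ (p : ℝ)) := by
  rw [← measurableSet_setOf, setOf_and]
  exact (MeasurableSet.const _).inter (measurableSet_le measurable_id measurable_const)

/-- The threshold map is measurable. -/
theorem measurable_threshold (u : Set ι) (p : I) : Measurable (threshold u p) := by
  rw [measurable_set_iff]
  intro i
  show Measurable fun U : ι → ℝ => (i ∈ u ∧ U i ≤ (p : ℝ))
  exact (measurable_threshold_coord u p i).comp (measurable_pi_apply i)

/-- `toNNReal p`, as an extended non-negative real, is `ENNReal.ofReal p`. -/
theorem coe_toNNReal_eq_ofReal (p : I) : ((toNNReal p : ℝ≥0) : ℝ≥0∞) = ENNReal.ofReal p :=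
  (ENNReal.ofReal_eq_coe_nnreal p.2.1).symm

/-- `toNNReal (σ p)`, as an extended non-negative real, is `ENNReal.ofReal (1 − p)`. -/
theorem coe_toNNReal_symm_eq_ofReal (p : I) :
    ((toNNReal (σ p) : ℝ≥0) : ℝ≥0∞) = ENNReal.ofReal (1 - p) :=
  (ENNReal.ofReal_eq_coe_nnreal (σ p).2.1).symm

/-- The law of one threshold coordinate is the Bernoulli law used by `setBernoulli`. -/
theorem unif_map_threshold_coord (u : Set ι) (p : I) (i : ι) :
    unif.map (fun x : ℝ => (i ∈ u ∧ x ≤ (p : ℝ))) =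
      toNNReal p • Measure.dirac (i ∈ u) + toNNReal (σ p) • Measure.dirac False := by
  refine Measure.ext_of_singleton fun q => ?_
  rw [Measure.map_apply (measurable_threshold_coord u p i) (measurableSet_singleton q),
    Measure.add_apply, Measure.smul_apply, Measure.smul_apply, Measure.dirac_apply,
    Measure.dirac_apply, ENNReal.smul_def, ENNReal.smul_def, smul_eq_mul, smul_eq_mul]
  by_cases hq : q
  · rw [eq_true hq]
    by_cases hi : i ∈ u
    · have hpre : (fun x : ℝ => (i ∈ u ∧ x ≤ (p : ℝ))) ⁻¹' {True} = Iic (p : ℝ) := by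
        ext x
        simp [hi]
      rw [hpre, unif_Iic, coe_toNNReal_eq_ofReal]
      simp [hi]
    · have hpre : (fun x : ℝ => (i ∈ u ∧ x ≤ (p : ℝ))) ⁻¹' {True} = ∅ := by
        ext x
        simp [hi]
      rw [hpre, measure_empty]
      simp [hi]
  · rw [eq_false hq]
    by_cases hi : i ∈ u
    · have hpre : (fun x : ℝ => (i ∈ u ∧ x ≤ (p : ℝ))) ⁻¹' {False} = Ioi (p : ℝ) := by
        ext x
        simp [hi, not_le]
      rw [hpre, unif_Ioi, coe_toNNReal_symm_eq_ofReal]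
      simp [hi]
    · have hpre : (fun x : ℝ => (i ∈ u ∧ x ≤ (p : ℝ))) ⁻¹' {False} = univ := by
        ext x
        simp [hi]
      rw [hpre, measure_univ, coe_toNNReal_eq_ofReal, coe_toNNReal_symm_eq_ofReal]
      have hi' : (i ∈ u) = False := eq_false hi
      rw [hi']
      simp only [Set.indicator_of_mem (mem_singleton False), Pi.one_apply, mul_one]
      rw [← ENNReal.ofReal_add p.2.1 (sub_nonneg.2 p.2.2)]
      simp

/-- The product of uniforms pushed through the threshold map is `setBer(u, p)`. -/
theorem map_threshold_eq_setBernoulli (u : Set ι) (p : I) :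
    (Measure.infinitePi fun _ : ι => unif).map (threshold u p) = setBernoulli u p := by
  have hcomp : threshold u p = (fun P : ι → Prop => {i | P i}) ∘
      fun U : ι → ℝ => fun i => (i ∈ u ∧ U i ≤ (p : ℝ)) := by
    funext U
    rfl
  have hmeas : Measurable fun U : ι → ℝ => fun i => (i ∈ u ∧ U i ≤ (p : ℝ)) :=
    measurable_pi_lambda _ fun i => (measurable_threshold_coord u p i).comp (measurable_pi_apply i)
  rw [hcomp, ← Measure.map_map measurable_setOf hmeas,
    Measure.infinitePi_map_pi _ (fun i => measurable_threshold_coord u p i), setBernoulli_eq_map]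
  congr 1
  congr 1
  funext i
  exact unif_map_threshold_coord u p i

/-- Monotonicity of `setBer(u, ·)` on measurable increasing events. -/
theorem setBernoulli_mono_of_isUpperSet (u : Set ι) {p q : I} (hpq : p ≤ q) {A : Set (Set ι)}
    (hA : IsUpperSet A) (hAm : MeasurableSet A) : setBernoulli u p A ≤ setBernoulli u q A := by
  rw [← map_threshold_eq_setBernoulli u p, ← map_threshold_eq_setBernoulli u q,
    Measure.map_apply (measurable_threshold u p) hAm,
    Measure.map_apply (measurable_threshold u q) hAm]
  exact measure_mono fun U hU => hA (threshold_mono u hpq U) hU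

end Coupling

/-! ### L1 for the percolation measures and its consequences -/

variable {d : ℕ}

/-- L1 · MONOTONE holds: `p ≤ q ⇒ P_p(A) ≤ P_q(A)` for every measurable increasing event. -/
theorem L1_Monotone_holds (d : ℕ) : L1_Monotone d :=
  fun _ _ hpq _ hA hAm => setBernoulli_mono_of_isUpperSet (bonds d) hpq hA hAm

/-- `θ_d` is non-decreasing on the unit interval. -/
theorem thetaI_mono : Monotone (thetaI d) := by
  intro p q hpq
  unfold thetaI
  exact ENNReal.toReal_mono (measure_ne_top _ _)
    (L1_Monotone_holds d p q hpq (percolates d) isUpperSet_percolates measurableSet_percolates)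

/-- `θ_d` is non-decreasing on `ℝ` (clamped). -/
theorem theta_mono : Monotone (theta d) :=
  fun _ _ hpq => thetaI_mono (Set.monotone_projIcc zero_le_one hpq)

/-- `θ_d` is non-decreasing on `[0,1]`. -/
theorem monotoneOn_theta : MonotoneOn (theta d) (Set.Icc 0 1) :=
  theta_mono.monotoneOn _

/-- Above `p_c(d)` the percolation probability is positive (`d ≥ 1`). -/
theorem theta_pos_of_pc_lt' (hd : 1 ≤ d) {p : ℝ} (hp : pc d < p) (hp1 : p ≤ 1) : 0 < theta d p :=
  theta_pos_of_pc_lt hd monotoneOn_theta hp hp1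

/-- Inf form = sup form of the critical probability (`d ≥ 1`): `p_c(d) = sup { p ∈ [0,1] : θ_d(p) = 0 }`. -/
theorem pc_eq_sSup_zeroSet' (hd : 1 ≤ d) : pc d = sSup (zeroSet d) :=
  pc_eq_sSup_zeroSet hd monotoneOn_theta

end Summit.Ventures.PercRepro0.Defs
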